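import Mathlib
import Summits.Ventures.PercRepro.TriangleCapCherryMantel

/-!
# PercRepro — ROW C-047 fails on the whole family `K_{3, k−3}`, `k ≥ 28` (p3, gen 28)

TriangleCapC047Refutation kills ROW C-047 at one point, `K_{3,25} ⊂ K₂₈`.  This module records the family
behind it in the kernel: on `D = K_{3, k−3}` (`k = c + 28`, `m = 3(k−3)`)

  `B_k(m) = C(k+2, 3) + C(k−8, 2) − C(k, 3)`   and   `Σ_v C(d(v), 2) = 3·C(k−3, 2) + 3(k−3)`,

and `B_k(m) − cherries = 27 − k < 0` for every `k ≥ 28` (P3-TRIANGLE-CAP.md §10w / §10x: the family's slack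
falls by one per vertex from `18` at `k = 9`; an exhaustive census at `k ≤ 10` cannot see the sign change).

* `nu_family` — the row's index `C(k−1, 2) + m − 1 = tri k + (k − 9)` lands `k − 9` into the run `R_{k+1}`;
* `B_family` — `B_k(3(k−3))` by `KK.P_closed`;
* `cherries_family`, `card_edges_family` — the graph side of `K_{3, k−3}` from `cherries_bip` / `card_edges_bip`;
* **`B_lt_cherries_family`** — `B (c+28) (3(c+25)) < cherries (bip (c+28) 3)` for every `c` (the excess is
  exactly `−(c+1)`, see `two_mul_excess_family`);
* **`exists_violation_of_ge`** — for every `k ≥ 28` there is a `K₄⁻`-free `D` on `Fin k` with `m ≥ 1` edges and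
  `B k m < cherries D`: the row is false at every `k ≥ 28`, not only at `28`.

Axioms: standard.
-/

namespace PercRepro

namespace TriangleCap

namespace C047

open Finset

/-- The row's index on `K_{3, c+25} ⊂ K_{c+28}`: `C(c+27, 2) + 3(c+25) − 1 = tri (c+28) + (c+19)`. -/
theorem nu_family (c : ℕ) :
    (c + 28 - 1).choose 2 + 3 * (c + 25) - 1 = KK.tri (c + 28) + (c + 19) := by
  rw [KK.tri_eq_choose]
  have e1 : c + 28 - 1 = c + 26 + 1 := by omega
  have e2 : 3 * (c + 25) - 1 = 3 * c + 74 := by omega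
  rw [e1]
  have h1 := two_mul_choose_two_succ (c + 26)
  have h2 := two_mul_choose_two_succ (c + 28)
  have h3 : (c + 26 + 1).choose 2 + 3 * (c + 25) = (c + 28 + 1).choose 2 + (c + 19) + 1 := by
    nlinarith [h1, h2]
  omega

/-- `B_{c+28}(3(c+25)) = C(c+30, 3) + C(c+20, 2) − C(c+28, 3)`. -/
theorem B_family (c : ℕ) :
    B (c + 28) (3 * (c + 25)) = (c + 28 + 2).choose 3 + (c + 19 + 1).choose 2 - (c + 28).choose 3 := by
  unfold B
  rw [nu_family, KK.P_closed (c + 28) (c + 19) (by omega)]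

/-- `Σ_v C(d(v), 2) = 3·C(c+25, 2) + 3(c+25)` on `K_{3, c+25}`. -/
theorem cherries_family (c : ℕ) :
    cherries (bip (c + 28) 3) = 3 * (c + 25).choose 2 + (c + 25) * 3 := by
  rw [cherries_bip (c + 28) 3 (by omega)]
  have e : c + 28 - 3 = c + 25 := by omega
  rw [e]
  rfl

/-- `K_{3, c+25}` has `3(c+25)` edges. -/
theorem card_edges_family (c : ℕ) : (bip (c + 28) 3).edgeFinset.card = 3 * (c + 25) := by
  rw [card_edges_bip (c + 28) 3 (by omega)]
  have e : c + 28 - 3 = c + 25 := by omega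
  rw [e]

/-- Pascal twice: `C(n+2, 3) = C(n, 3) + C(n, 2) + C(n+1, 2)`. -/
theorem choose_three_add_two (n : ℕ) :
    (n + 2).choose 3 = n.choose 3 + (n.choose 2 + (n + 1).choose 2) := by
  rw [Nat.choose_succ_succ' (n + 1) 2, Nat.choose_succ_succ' n 2]
  ring

/-- The excess of the family, doubled: `2·(3·C(c+25,2) + 3(c+25)) = 2·B + 2(c + 1)` — i.e.
`cherries − B = c + 1 = k − 27`. -/
theorem two_mul_excess_family (c : ℕ) :
    2 * (3 * (c + 25).choose 2 + (c + 25) * 3) =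
      2 * ((c + 28 + 2).choose 3 + (c + 19 + 1).choose 2 - (c + 28).choose 3) + 2 * (c + 1) := by
  rw [choose_three_add_two (c + 28)]
  have hA := two_mul_choose_two_succ (c + 27)
  have hB := two_mul_choose_two_succ (c + 28)
  have hC := two_mul_choose_two_succ (c + 19)
  have hD := two_mul_choose_two_succ (c + 24)
  have e1 : (c + 28).choose 3 + ((c + 28).choose 2 + (c + 28 + 1).choose 2) + (c + 19 + 1).choose 2 -
      (c + 28).choose 3 = (c + 28).choose 2 + (c + 28 + 1).choose 2 + (c + 19 + 1).choose 2 := by omega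
  rw [e1]
  have e2 : (c + 28).choose 2 = (c + 27 + 1).choose 2 := rfl
  have e3 : (c + 25).choose 2 = (c + 24 + 1).choose 2 := rfl
  rw [e2, e3]
  nlinarith [hA, hB, hC, hD]

/-- **ROW C-047 FAILS ON EVERY `K_{3, k−3}`, `k ≥ 28`:** `B_k(3(k−3)) < Σ_v C(d(v), 2)`. -/
theorem B_lt_cherries_family (c : ℕ) : B (c + 28) (3 * (c + 25)) < cherries (bip (c + 28) 3) := by
  rw [B_family, cherries_family]
  have h := two_mul_excess_family c
  omega

/-- **ROW C-047 IS FALSE AT EVERY `k ≥ 28`:** a `K₄⁻`-free graph on `Fin k` with `m ≥ 1` edges and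
`B_k(m) < Σ_v C(d(v), 2)`. -/
theorem exists_violation_of_ge (k : ℕ) (hk : 28 ≤ k) :
    ∃ (D : SimpleGraph (Fin k)) (_ : DecidableRel D.Adj),
      K4mFree D ∧ 1 ≤ D.edgeFinset.card ∧ B k D.edgeFinset.card < cherries D := by
  obtain ⟨c, rfl⟩ := Nat.exists_eq_add_of_le' hk
  refine ⟨bip (c + 28) 3, inferInstance, k4mFree_bip (c + 28) 3, ?_, ?_⟩
  · rw [card_edges_family]
    omega
  · rw [card_edges_family]
    exact B_lt_cherries_family c

end C047

end TriangleCap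

end PercRepro
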